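import Literature.NumberTheory.BeurlingPrimes.BeurlingPerronFormula
import Literature.NumberTheory.BeurlingPrimes.PerronShift
import HarnessLib

/-!
# Perron inversion of order one for weighted Beurling integers: `A_w(x) = Σ_p Re(r_p) x^p/p + O(x^{σ₁+η})`

Topic `Literature/NumberTheory/BeurlingPrimes`. Everything in this file is PROVED (definitions + theorems).

This file assembles the tree's Perron tools — the order-one Perron formula for Beurling integers
(`BeurlingPerronFormula.lean`) and the contour shift across finitely many real simple poles with the estimate
of the shifted integral (`PerronShift.lean`) — into the inversion statement that Broucke–Debruyne–Révész
(arXiv:2309.01567) use three times: in the proof of Theorem 3.2 ((3.5)–(3.8): "`N_𝒫(x) ≤ ∫_x^{x+1} N_𝒫(u) du =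
(1/2πi)∫ ((x+1)^{s+1} − x^{s+1})/(s(s+1)) ζ_𝒫(s) ds` … By the residue theorem … `= ax + Σ (residues) +
O(x^{1/2} exp(c(log x)^{2/3}))`"), in §4, and in §5 p. 16 for the deleted primes `𝒫_𝒮`: "A small adaptation of the
Perron inversion argument of Section 3 from (3.5) onwards where the location of the pole is now moved to `α`
and the bounds on the half-plane `Re s > α/2 + ε` for `|ζ(s)|` are now `O_ε(|t|^ε)` delivers that
`N_𝒮(x) = a x^α + O_ε(x^{α/2+ε})` … The exact same inversion argument applied to the non-decreasing function
`N_𝒮(x) + M_𝒮(x)` whose Mellin–Stieltjes transform is `ζ_𝒮(s) + 1/ζ_𝒮(s)` then gives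
`N_𝒮(x) + M_𝒮(x) = a x^α + O_ε(x^{α/2+ε})`."

To cover the second application we work with a WEIGHT `w ≥ 0` on the generalized integers (`w ≡ 1` for `N_𝒫`,
`w = 1 + μ_𝒫` for `N_𝒫 + M_𝒫`):

* `wCount P w x = Σ_{n_k ≤ x} w_k`, `wRiesz P w y = Σ_k w_k (y − n_k)⁺`, `wSeries P w s = Σ_k w_k n_k^{−s}`;
  `wCount x ≤ wRiesz(x+1) − wRiesz(x)` and `wRiesz(x) − wRiesz(x−1) ≤ wCount x` (monotonicity, as for `N_𝒫`);
* `wRiesz_sub_eq_integral` — the Perron formula `wRiesz(y₂) − wRiesz(y₁) = (1/2π)∫ K(y₁,y₂;σ+it) wSeries(σ+it) dt`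
  for every `σ > 0` with `Σ_j λ_j^{−σ} < ∞` and bounded `w` (tree `posPart_sub_eq_integral`, Fubini);
* `wCount_asymptotic` — **the inversion theorem**: if on the line `Re s = κ` the series `wSeries` equals
  `Σ_{p ∈ S} r_p/(s − p) + H(s)` with finitely many real simple poles `p ∈ (σ₁, κ)`, `p ≤ 1`, `H` holomorphic on
  `Re s > σ₀` (`0 ≤ σ₀ < σ₁ < κ`) and `‖H(u+it)‖ ≤ B₀(1+|t|)^η` on the strip `σ₁ ≤ u ≤ κ` (`0 < η < 1`), then
  `|wCount(x) − Σ_p Re(r_p) x^p/p| ≤ C x^{σ₁+η}` for `x ≥ 2`.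

## References
* [BrouckeDebruyneRevesz2023] F. Broucke, G. Debruyne, Sz. Gy. Révész, *Some examples of well-behaved Beurling
  number systems*, arXiv:2309.01567 (Trans. AMS 2024), proof of Theorem 3.2 (3.5)–(3.8) and §5 p. 16 (read).
* [BrouckeVindas2024] F. Broucke, J. Vindas, Math. Z. 307 (2024), arXiv:2102.08478, proof of Theorem 3.1 (the
  order-one Perron inversion "in the spirit of Diamond–Zhang").
-/

noncomputable section

open Complex Filter Set MeasureTheory Real
open scoped Topology

namespace Literature.NumberTheory.BeurlingPrimes

open Literature.Barriers.RiemannHypothesis Literature.NumberTheory.LFunctions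

variable (P : BeurlingPrimes) (w : (ℕ →₀ ℕ) → ℝ)

/-! ### Weighted counts, Riesz means and Dirichlet series -/

/-- The weighted count `A_w(x) = Σ_{n_k ≤ x} w_k`. [cite: BrouckeDebruyneRevesz2023, §5 p. 16 ("`N_𝒮(x) + M_𝒮(x)`")] -/
def wCount (x : ℝ) : ℝ := ∑ k ∈ Hilberdink.intFinset P x, w k

/-- The weighted Riesz mean of order one `Σ_k w_k (y − n_k)⁺ = ∫₀^y A_w(u) du`. [cite: BrouckeDebruyneRevesz2023, (3.5)] -/
def wRiesz (y : ℝ) : ℝ := ∑' k : ℕ →₀ ℕ, w k * max (y - P.genInt k) 0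

/-- The weighted Dirichlet series `Σ_k w_k n_k^{−s}` (`ζ_𝒫` for `w ≡ 1`, `ζ_𝒫 + 1/ζ_𝒫` for `w = 1 + μ_𝒫`).
[cite: BrouckeDebruyneRevesz2023, §5 p. 16] -/
def wSeries (s : ℂ) : ℂ := ∑' k : ℕ →₀ ℕ, (w k : ℂ) * ((P.genInt k : ℝ) : ℂ) ^ (-s)

variable {P w}

/-- `wRiesz y` is the finite sum `Σ_{n_k ≤ y} w_k (y − n_k)`. [folklore] -/
theorem wRiesz_eq_sum (y : ℝ) : wRiesz P w y = ∑ k ∈ Hilberdink.intFinset P y, w k * (y - P.genInt k) := by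
  unfold wRiesz
  rw [tsum_eq_sum (s := Hilberdink.intFinset P y)]
  · refine Finset.sum_congr rfl fun k hk ↦ ?_
    rw [Hilberdink.mem_intFinset] at hk
    rw [max_eq_left (by linarith)]
  · intro k hk
    rw [Hilberdink.mem_intFinset, not_le] at hk
    rw [max_eq_right (by linarith), mul_zero]

/-- **`A_w(x) ≤ wRiesz(x+1) − wRiesz(x)`** for `w ≥ 0`. [cite: BrouckeDebruyneRevesz2023, (3.6)] -/
theorem wCount_le_wRiesz_sub (hw0 : ∀ k, 0 ≤ w k) (x : ℝ) :
    wCount P w x ≤ wRiesz P w (x + 1) - wRiesz P w x := by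
  classical
  rw [wRiesz_eq_sum (x + 1), wRiesz_eq_sum x, wCount]
  have hsub : Hilberdink.intFinset P x ⊆ Hilberdink.intFinset P (x + 1) :=
    Hilberdink.intFinset_mono P (by linarith)
  rw [← Finset.sum_sdiff hsub, add_sub_assoc, ← Finset.sum_sub_distrib]
  have h1 : ∑ k ∈ Hilberdink.intFinset P x, (w k * (x + 1 - P.genInt k) - w k * (x - P.genInt k)) =
      ∑ k ∈ Hilberdink.intFinset P x, w k := Finset.sum_congr rfl fun k _ ↦ by ring
  rw [h1]
  have h2 : 0 ≤ ∑ k ∈ Hilberdink.intFinset P (x + 1) \ Hilberdink.intFinset P x, w k * (x + 1 - P.genInt k) :=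
    Finset.sum_nonneg fun k hk ↦ by
      rw [Finset.mem_sdiff, Hilberdink.mem_intFinset] at hk
      exact mul_nonneg (hw0 k) (by linarith [hk.1])
  linarith

/-- **`wRiesz(x) − wRiesz(x−1) ≤ A_w(x)`** for `w ≥ 0`. [cite: BrouckeDebruyneRevesz2023, (3.6)] -/
theorem wRiesz_sub_le_wCount (hw0 : ∀ k, 0 ≤ w k) (x : ℝ) :
    wRiesz P w x - wRiesz P w (x - 1) ≤ wCount P w x := by
  classical
  rw [wRiesz_eq_sum x, wCount]
  have hN1 : wRiesz P w (x - 1) = ∑ k ∈ Hilberdink.intFinset P x, w k * max (x - 1 - P.genInt k) 0 := by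
    unfold wRiesz
    rw [tsum_eq_sum (s := Hilberdink.intFinset P x)]
    intro k hk
    rw [Hilberdink.mem_intFinset, not_le] at hk
    rw [max_eq_right (by linarith), mul_zero]
  rw [hN1, ← Finset.sum_sub_distrib]
  refine Finset.sum_le_sum fun k _ ↦ ?_
  have := le_max_left (x - 1 - P.genInt k) 0
  have h0 := hw0 k
  nlinarith

/-! ### The Perron formula for the weighted Riesz mean -/

section series

variable {W : ℝ} (hwW : ∀ k, |w k| ≤ W)
include hwW

/-- `Σ_k ‖w_k n_k^{−s}‖ < ∞` for `Re s > 0` with `Σ_j λ_j^{−σ} < ∞`. [folklore] -/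
theorem summable_norm_wTerm {s : ℂ} (hs : 0 < s.re) (hsum : Summable fun j ↦ P.prime j ^ (-s.re)) :
    Summable fun k : ℕ →₀ ℕ ↦ ‖(w k : ℂ) * ((P.genInt k : ℝ) : ℂ) ^ (-s)‖ := by
  have hW : 0 ≤ W := (abs_nonneg _).trans (hwW 0)
  refine Summable.of_nonneg_of_le (fun k ↦ norm_nonneg _) (fun k ↦ ?_)
    ((P.summable_norm_genInt_cpow hs hsum).mul_left W)
  rw [norm_mul, Complex.norm_real, Real.norm_eq_abs]
  exact mul_le_mul_of_nonneg_right (hwW k) (norm_nonneg _)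

/-- `‖wSeries(σ + it)‖ ≤ W Σ_k n_k^{−σ}` for `σ > 0`. [folklore] -/
theorem norm_wSeries_le {σ : ℝ} (hσ : 0 < σ) (hsum : Summable fun j ↦ P.prime j ^ (-σ)) (t : ℝ) :
    ‖wSeries P w ((σ : ℂ) + t * I)‖ ≤ W * ∑' k : ℕ →₀ ℕ, ‖((P.genInt k : ℝ) : ℂ) ^ (-(σ : ℂ))‖ := by
  have h1 := summable_norm_wTerm hwW (s := (σ : ℂ) + t * I) (by simpa using hσ) (by simpa using hsum)
  unfold wSeries
  refine (norm_tsum_le_tsum_norm h1).trans ?_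
  rw [← tsum_mul_left]
  refine Summable.tsum_le_tsum (fun k ↦ ?_) h1
    ((P.summable_norm_genInt_cpow (s := (σ : ℂ)) (by simpa using hσ) (by simpa using hsum)).mul_left W)
  rw [norm_mul, Complex.norm_real, Real.norm_eq_abs, norm_cpow_eq_rpow_re_of_pos (P.genInt_pos k),
    norm_cpow_eq_rpow_re_of_pos (P.genInt_pos k)]
  simp only [neg_re, add_re, ofReal_re, mul_re, I_re, mul_zero, ofReal_im, I_im, mul_one, sub_self, add_zero]
  exact mul_le_mul_of_nonneg_right (hwW k) (Real.rpow_nonneg (P.genInt_pos k).le _)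

/-- `t ↦ wSeries(σ + it)` is continuous (`σ > 0`). [folklore] -/
theorem continuous_wSeries_vertical {σ : ℝ} (hσ : 0 < σ) (hsum : Summable fun j ↦ P.prime j ^ (-σ)) :
    Continuous fun t : ℝ ↦ wSeries P w ((σ : ℂ) + t * I) := by
  have hS := summable_norm_wTerm hwW (s := (σ : ℂ)) (by simpa using hσ) (by simpa using hsum)
  unfold wSeries
  refine continuous_tsum (fun k ↦ ?_) hS (fun k t ↦ ?_)
  · refine continuous_const.mul (continuous_iff_continuousAt.2 fun t ↦ ?_)
    exact (continuousAt_const_cpow (ofReal_ne_zero.2 (P.genInt_pos k).ne')).comp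
      (f := fun t : ℝ ↦ -((σ : ℂ) + t * I)) (by fun_prop)
  · rw [norm_mul, norm_mul, norm_cpow_eq_rpow_re_of_pos (P.genInt_pos k), norm_cpow_eq_rpow_re_of_pos (P.genInt_pos k)]
    simp

/-- **The weighted Perron formula**: for `y > 0` and `σ > 0` with `Σ_j λ_j^{−σ} < ∞`,
`Σ_k w_k (y − n_k)⁺ = (1/2π)∫ y^{1+s} wSeries(s)/(s(s+1)) dt`, `s = σ + it`. [cite: BrouckeDebruyneRevesz2023, (3.5)] -/
theorem wRiesz_eq_integral {y : ℝ} (hy : 0 < y) {σ : ℝ} (hσ : 0 < σ) (hsum : Summable fun j ↦ P.prime j ^ (-σ)) :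
    ((wRiesz P w y : ℝ) : ℂ) =
      (1 / (2 * π) : ℂ) * ∫ t : ℝ, (y : ℂ) ^ (1 + ((σ : ℂ) + t * I)) * wSeries P w ((σ : ℂ) + t * I) *
        (1 / (((σ : ℂ) + t * I) * ((σ : ℂ) + t * I + 1))) := by
  haveI : Countable (ℕ →₀ ℕ) := encode_injective.countable
  have hW : 0 ≤ W := (abs_nonneg _).trans (hwW 0)
  have hy0 : (y : ℂ) ≠ 0 := ofReal_ne_zero.2 hy.ne'
  set K : ℝ → ℂ := fun t ↦ 1 / (((σ : ℂ) + t * I) * ((σ : ℂ) + t * I + 1)) with hK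
  set G : (ℕ →₀ ℕ) → ℝ → ℂ := fun k t ↦ (y : ℂ) ^ (1 + ((σ : ℂ) + t * I)) *
    ((P.genInt k : ℝ) : ℂ) ^ (-((σ : ℂ) + t * I)) with hG
  set F : (ℕ →₀ ℕ) → ℝ → ℂ := fun k t ↦ (w k : ℂ) * (G k t * K t) with hF
  have hnormG : ∀ k t, ‖G k t‖ = y ^ (1 + σ) * ‖((P.genInt k : ℝ) : ℂ) ^ (-(σ : ℂ))‖ := by
    intro k t
    simp only [hG, norm_mul]
    congr 1
    · rw [norm_cpow_eq_rpow_re_of_pos hy]; simp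
    · rw [norm_cpow_eq_rpow_re_of_pos (P.genInt_pos k), norm_cpow_eq_rpow_re_of_pos (P.genInt_pos k)]
      simp
  have hcontG : ∀ k, Continuous (G k) := by
    intro k
    simp only [hG]
    refine Continuous.mul ?_ ?_
    · refine continuous_iff_continuousAt.2 fun t ↦ ?_
      exact (continuousAt_const_cpow hy0).comp (f := fun t : ℝ ↦ 1 + ((σ : ℂ) + t * I)) (by fun_prop)
    · refine continuous_iff_continuousAt.2 fun t ↦ ?_
      exact (continuousAt_const_cpow (ofReal_ne_zero.2 (P.genInt_pos k).ne')).comp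
        (f := fun t : ℝ ↦ -((σ : ℂ) + t * I)) (by fun_prop)
  have hintK : Integrable K := integrable_kernel hσ
  have hintF : ∀ k, Integrable (F k) := fun k ↦
    (hintK.bdd_mul (hcontG k).aestronglyMeasurable (Eventually.of_forall fun t ↦ (hnormG k t).le)).const_mul _
  -- summability of the norms
  have hsumF : Summable fun k ↦ ∫ t, ‖F k t‖ := by
    have hS : Summable fun k : ℕ →₀ ℕ ↦ ‖((P.genInt k : ℝ) : ℂ) ^ (-(σ : ℂ))‖ :=
      P.summable_norm_genInt_cpow (s := (σ : ℂ)) (by simpa using hσ) (by simpa using hsum)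
    have h2 := ((hS.mul_left (W * y ^ (1 + σ))).mul_right (∫ t : ℝ, ‖K t‖))
    refine Summable.of_nonneg_of_le (fun k ↦ integral_nonneg fun t ↦ norm_nonneg _) (fun k ↦ ?_) h2
    rw [← integral_const_mul]
    refine integral_mono_of_nonneg (Eventually.of_forall fun t ↦ norm_nonneg _) (hintK.norm.const_mul _)
      (Eventually.of_forall fun t ↦ ?_)
    simp only [hF, norm_mul, hnormG k t, Complex.norm_real, Real.norm_eq_abs]
    have h1 := hwW k
    have h3 : 0 ≤ ‖((P.genInt k : ℝ) : ℂ) ^ (-(σ : ℂ))‖ := norm_nonneg _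
    have h4 : 0 ≤ ‖K t‖ := norm_nonneg _
    have h5 : 0 ≤ y ^ (1 + σ) := by positivity
    calc |w k| * (y ^ (1 + σ) * ‖((P.genInt k : ℝ) : ℂ) ^ (-(σ : ℂ))‖ * ‖K t‖)
        ≤ W * (y ^ (1 + σ) * ‖((P.genInt k : ℝ) : ℂ) ^ (-(σ : ℂ))‖ * ‖K t‖) :=
          mul_le_mul_of_nonneg_right h1 (by positivity)
      _ = W * y ^ (1 + σ) * ‖((P.genInt k : ℝ) : ℂ) ^ (-(σ : ℂ))‖ * ‖K t‖ := by ring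
  -- left side: sum of the terms
  have hterm : ∀ k : ℕ →₀ ℕ, ((w k * max (y - P.genInt k) 0 : ℝ) : ℂ) = (1 / (2 * π) : ℂ) * ∫ t, F k t := by
    intro k
    rw [ofReal_mul, posPart_sub_eq_integral hy (P.genInt_pos k) hσ, hF]
    simp only
    rw [integral_const_mul]
    ring
  have hlhs : ((wRiesz P w y : ℝ) : ℂ) = ∑' k : ℕ →₀ ℕ, ((w k * max (y - P.genInt k) 0 : ℝ) : ℂ) := by
    rw [wRiesz, ofReal_tsum]
  rw [hlhs, tsum_congr hterm, tsum_mul_left, integral_tsum_of_summable_integral_norm hintF hsumF]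
  congr 1
  refine integral_congr_ae (Eventually.of_forall fun t ↦ ?_)
  simp only [hF, hG, hK]
  rw [wSeries, ← tsum_mul_left, ← tsum_mul_right]
  exact tsum_congr fun k ↦ by ring

/-- The integrand of the weighted Perron integral is integrable (`σ > 0`, `y > 0`). [cite: BrouckeDebruyneRevesz2023, (3.5)] -/
theorem integrable_wPerronIntegrand {y : ℝ} (hy : 0 < y) {σ : ℝ} (hσ : 0 < σ) (hsum : Summable fun j ↦ P.prime j ^ (-σ)) :
    Integrable fun t : ℝ ↦ (y : ℂ) ^ (1 + ((σ : ℂ) + t * I)) * wSeries P w ((σ : ℂ) + t * I) *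
      (1 / (((σ : ℂ) + t * I) * ((σ : ℂ) + t * I + 1))) := by
  have hW : 0 ≤ W := (abs_nonneg _).trans (hwW 0)
  have hy0 : (y : ℂ) ≠ 0 := ofReal_ne_zero.2 hy.ne'
  set A : ℝ := ∑' k : ℕ →₀ ℕ, ‖((P.genInt k : ℝ) : ℂ) ^ (-(σ : ℂ))‖ with hA
  refine (integrable_kernel hσ).bdd_mul (c := y ^ (1 + σ) * (W * A)) ?_ (Eventually.of_forall fun t ↦ ?_)
  · refine Continuous.aestronglyMeasurable (Continuous.mul ?_ (continuous_wSeries_vertical hwW hσ hsum))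
    refine continuous_iff_continuousAt.2 fun t ↦ ?_
    exact (continuousAt_const_cpow hy0).comp (f := fun t : ℝ ↦ 1 + ((σ : ℂ) + t * I)) (by fun_prop)
  · rw [norm_mul, norm_cpow_eq_rpow_re_of_pos hy]
    have hre : (1 + ((σ : ℂ) + t * I)).re = 1 + σ := by simp
    rw [hre]
    exact mul_le_mul_of_nonneg_left (norm_wSeries_le hwW hσ hsum t) (by positivity)

/-- **The differenced weighted Perron integral**: for `0 < y₁, y₂` and `σ > 0`,
`wRiesz(y₂) − wRiesz(y₁) = (1/2π) ∫ K(y₁,y₂;σ+it) wSeries(σ+it) dt` with the order-one Perron kernel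
`K(y₁,y₂;s) = (y₂^{1+s} − y₁^{1+s})/(s(s+1))` (`perronKernel`). [cite: BrouckeDebruyneRevesz2023, (3.5)–(3.6)] -/
theorem wRiesz_sub_eq_integral {y₁ y₂ : ℝ} (hy₁ : 0 < y₁) (hy₂ : 0 < y₂) {σ : ℝ} (hσ : 0 < σ)
    (hsum : Summable fun j ↦ P.prime j ^ (-σ)) :
    ((wRiesz P w y₂ - wRiesz P w y₁ : ℝ) : ℂ) =
      (1 / (2 * π) : ℂ) * ∫ t : ℝ, perronKernel y₁ y₂ ((σ : ℂ) + t * I) * wSeries P w ((σ : ℂ) + t * I) := by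
  have h₁ := wRiesz_eq_integral hwW hy₁ hσ hsum
  have h₂ := wRiesz_eq_integral hwW hy₂ hσ hsum
  have hi₁ := integrable_wPerronIntegrand hwW hy₁ hσ hsum
  have hi₂ := integrable_wPerronIntegrand hwW hy₂ hσ hsum
  rw [ofReal_sub, h₁, h₂, ← mul_sub, ← integral_sub hi₂ hi₁]
  congr 1
  refine integral_congr_ae (Eventually.of_forall fun t ↦ ?_)
  simp only [perronKernel]
  ring

end series

/-! ### Elementary estimates for the inversion theorem -/

/-- On a horizontal line at height `|T| ≥ 1` the pole part is bounded: `‖Σ r_p/(s − p)‖ ≤ Σ ‖r_p‖`. [folklore] -/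
theorem norm_polePart_le_of_one_le_im (S : Finset ℝ) (r : ℝ → ℂ) {s : ℂ} (hs : 1 ≤ |s.im|) :
    ‖polePart S r s‖ ≤ ∑ p ∈ S, ‖r p‖ := by
  unfold polePart
  refine (norm_sum_le _ _).trans (Finset.sum_le_sum fun p _ ↦ ?_)
  rw [norm_div]
  have h1 : 1 ≤ ‖s - (p : ℂ)‖ := by
    have := abs_im_le_norm (s - (p : ℂ))
    simp only [sub_im, ofReal_im, sub_zero] at this
    linarith
  exact div_le_self (norm_nonneg _) h1

/-- On the vertical line `Re s = u` (`u ≠ p` for all poles) the pole part is bounded: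
`‖Σ r_p/(u + it − p)‖ ≤ Σ ‖r_p‖/|u − p|`. [folklore] -/
theorem norm_polePart_le_line (S : Finset ℝ) (r : ℝ → ℂ) {u : ℝ} (hu : ∀ p ∈ S, u ≠ p) (t : ℝ) :
    ‖polePart S r ((u : ℂ) + t * I)‖ ≤ ∑ p ∈ S, ‖r p‖ / |u - p| := by
  unfold polePart
  refine (norm_sum_le _ _).trans (Finset.sum_le_sum fun p hp ↦ ?_)
  rw [norm_div]
  have hup : 0 < |u - p| := abs_pos.mpr (sub_ne_zero.mpr (hu p hp))
  refine div_le_div_of_nonneg_left (norm_nonneg _) hup ?_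
  have := abs_re_le_norm ((u : ℂ) + t * I - (p : ℂ))
  simpa using this

/-- `t ↦ Σ r_p/(u + it − p)` is continuous when the line `Re s = u` avoids the poles. [folklore] -/
theorem continuous_polePart_line (S : Finset ℝ) (r : ℝ → ℂ) {u : ℝ} (hu : ∀ p ∈ S, u ≠ p) :
    Continuous fun t : ℝ ↦ polePart S r ((u : ℂ) + t * I) := by
  unfold polePart
  refine continuous_finsetSum _ fun p hp ↦ ?_
  refine Continuous.div continuous_const (by fun_prop) fun t h ↦ ?_
  have := congrArg Complex.re h
  simp only [sub_re, add_re, ofReal_re, mul_re, I_re, mul_zero, ofReal_im, I_im, mul_one, sub_self, add_zero,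
    zero_re] at this
  exact hu p hp (by linarith)

/-- `∫₀^X (1+t)^η/(σ+t) dt ≤ (1/σ + 1)(1+X)^η/η` for `σ, η, X > 0`
(`(1+t)/(σ+t) ≤ max(1, 1/σ)` and `∫₀^X (1+t)^{η−1} dt = ((1+X)^η − 1)/η`). [folklore] -/
theorem setIntegral_Ioc_rpow_div_le {σ η X : ℝ} (hσ : 0 < σ) (hη0 : 0 < η) (hX : 0 < X) :
    IntegrableOn (fun t : ℝ ↦ (1 + t) ^ η / (σ + t)) (Ioc 0 X) ∧
      ∫ t in Ioc 0 X, (1 + t) ^ η / (σ + t) ≤ (1 / σ + 1) * (1 + X) ^ η / η := by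
  have hcont : ContinuousOn (fun t : ℝ ↦ (1 + t) ^ η / (σ + t)) (Icc 0 X) := by
    refine ContinuousOn.div ?_ (by fun_prop) fun t ht ↦ by linarith [ht.1]
    exact ContinuousOn.rpow_const (by fun_prop) fun t ht ↦ Or.inl (by linarith [ht.1])
  have hint : IntegrableOn (fun t : ℝ ↦ (1 + t) ^ η / (σ + t)) (Ioc 0 X) :=
    (hcont.integrableOn_Icc).mono_set Ioc_subset_Icc_self
  refine ⟨hint, ?_⟩
  -- pointwise: `(1+t)^η/(σ+t) ≤ (1/σ+1) (1+t)^{η−1}` on `[0, X]`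
  have hpt : ∀ t ∈ Icc (0 : ℝ) X, (1 + t) ^ η / (σ + t) ≤ (1 / σ + 1) * (1 + t) ^ (η - 1) := by
    intro t ht
    have ht0 : 0 ≤ t := ht.1
    have h1t : 0 < 1 + t := by linarith
    have hσt : 0 < σ + t := by linarith
    rw [div_le_iff₀ hσt, Real.rpow_sub_one h1t.ne', show (1 / σ + 1) * ((1 + t) ^ η / (1 + t)) * (σ + t)
      = (1 + t) ^ η * ((1 / σ + 1) * (σ + t) / (1 + t)) by ring]
    refine le_mul_of_one_le_right (Real.rpow_nonneg h1t.le _) ?_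
    rw [le_div_iff₀ h1t]
    have : 1 / σ * σ = 1 := by field_simp
    nlinarith [mul_nonneg (show 0 ≤ 1 / σ by positivity) ht0]
  have hint2 : IntegrableOn (fun t : ℝ ↦ (1 / σ + 1) * (1 + t) ^ (η - 1)) (Ioc 0 X) := by
    refine ((ContinuousOn.rpow_const (by fun_prop) fun t ht ↦ Or.inl ?_).integrableOn_Icc.mono_set
      Ioc_subset_Icc_self).const_mul _
    exact (show (1 : ℝ) + t ≠ 0 by linarith [ht.1])
  calc ∫ t in Ioc 0 X, (1 + t) ^ η / (σ + t) ≤ ∫ t in Ioc 0 X, (1 / σ + 1) * (1 + t) ^ (η - 1) :=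
        setIntegral_mono_on hint hint2 measurableSet_Ioc fun t ht ↦ hpt t (Ioc_subset_Icc_self ht)
    _ = (1 / σ + 1) * (((1 + X) ^ η - 1) / η) := by
        rw [integral_const_mul, ← intervalIntegral.integral_of_le hX.le,
          intervalIntegral.integral_comp_add_left (fun u : ℝ ↦ u ^ (η - 1)) 1, integral_rpow (Or.inl (by linarith))]
        norm_num
    _ ≤ (1 / σ + 1) * (1 + X) ^ η / η := by
        rw [mul_div_assoc]
        refine mul_le_mul_of_nonneg_left ?_ (by positivity)
        exact div_le_div_of_nonneg_right (by linarith) hη0.le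

/-- `∫_X^∞ (1+t)^η/t² dt ≤ 2^η X^{η−1}/(1−η)` for `X ≥ 1`, `0 ≤ η < 1` (`1 + t ≤ 2t` on `[X, ∞)`). [folklore] -/
theorem setIntegral_Ioi_rpow_div_sq_le {η X : ℝ} (hη0 : 0 ≤ η) (hη1 : η < 1) (hX : 1 ≤ X) :
    IntegrableOn (fun t : ℝ ↦ (1 + t) ^ η / t ^ 2) (Ioi X) ∧
      ∫ t in Ioi X, (1 + t) ^ η / t ^ 2 ≤ (2 : ℝ) ^ η * X ^ (η - 1) / (1 - η) := by
  have hX0 : 0 < X := by linarith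
  have hdom : IntegrableOn (fun t : ℝ ↦ (2 : ℝ) ^ η * t ^ (η - 2)) (Ioi X) :=
    (integrableOn_Ioi_rpow_of_lt (by linarith) hX0).const_mul _
  have hpt : ∀ t ∈ Ioi X, (1 + t) ^ η / t ^ 2 ≤ (2 : ℝ) ^ η * t ^ (η - 2) := by
    intro t ht
    have ht1 : 1 ≤ t := hX.trans (le_of_lt ht)
    have ht0 : 0 < t := by linarith
    have h1 : (1 + t) ^ η ≤ (2 * t) ^ η := Real.rpow_le_rpow (by linarith) (by linarith) hη0
    rw [Real.mul_rpow zero_le_two ht0.le] at h1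
    rw [div_le_iff₀ (by positivity), show (2 : ℝ) ^ η * t ^ (η - 2) * t ^ 2 = 2 ^ η * t ^ η by
      rw [mul_assoc, ← Real.rpow_two, ← Real.rpow_add ht0]; ring_nf]
    exact h1
  have hmeas : ContinuousOn (fun t : ℝ ↦ (1 + t) ^ η / t ^ 2) (Ioi X) := by
    refine ContinuousOn.div ?_ (by fun_prop) fun t ht ↦ by
      have : 0 < t := hX0.trans ht
      positivity
    exact ContinuousOn.rpow_const (by fun_prop) fun t ht ↦ Or.inl (by have := hX0.trans ht; linarith)
  have hint : IntegrableOn (fun t : ℝ ↦ (1 + t) ^ η / t ^ 2) (Ioi X) := by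
    refine Integrable.mono' hdom (hmeas.aestronglyMeasurable measurableSet_Ioi) ?_
    rw [ae_restrict_iff' measurableSet_Ioi]
    refine Eventually.of_forall fun t ht ↦ ?_
    rw [Real.norm_eq_abs, abs_of_nonneg (by have := hX0.trans ht; positivity)]
    exact hpt t ht
  refine ⟨hint, ?_⟩
  calc ∫ t in Ioi X, (1 + t) ^ η / t ^ 2 ≤ ∫ t in Ioi X, (2 : ℝ) ^ η * t ^ (η - 2) :=
        setIntegral_mono_on hint hdom measurableSet_Ioi hpt
    _ = (2 : ℝ) ^ η * X ^ (η - 1) / (1 - η) := by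
        rw [integral_const_mul, integral_Ioi_rpow_of_lt (by linarith) hX0, show η - 2 + 1 = η - 1 by ring]
        have h1 : η - 1 ≠ 0 := by linarith
        have h2 : 1 - η ≠ 0 := by linarith
        rw [show -X ^ (η - 1) / (η - 1) = X ^ (η - 1) / (1 - η) by
          rw [div_eq_div_iff h1 h2]; ring]
        ring

/-- **The order-one Perron kernel at a real point**: for `1 ≤ y₁`, `y₂ = y₁ + 1` and `0 < p ≤ 1`, `K(y₁,y₂;p)` is
real and within `1/p` of both `y₁^p/p` and `y₂^p/p`: `y₁^p/p ≤ K ≤ y₂^p/p`, `y₂^p − y₁^p ≤ 1`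
(`y₂^{1+p} − y₁^{1+p} = (1+p)∫_{y₁}^{y₂} u^p du`). [cite: BrouckeDebruyneRevesz2023, (3.8) ("`= ax + …`")] -/
theorem perronKernel_real_bounds {y₁ p : ℝ} (hy₁ : 1 ≤ y₁) (hp0 : 0 < p) (hp1 : p ≤ 1) :
    perronKernel y₁ (y₁ + 1) (p : ℂ) = ((((y₁ + 1) ^ (1 + p) - y₁ ^ (1 + p)) / (p * (p + 1)) : ℝ) : ℂ) ∧
      y₁ ^ p / p ≤ ((y₁ + 1) ^ (1 + p) - y₁ ^ (1 + p)) / (p * (p + 1)) ∧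
      ((y₁ + 1) ^ (1 + p) - y₁ ^ (1 + p)) / (p * (p + 1)) ≤ (y₁ + 1) ^ p / p ∧
      (y₁ + 1) ^ p - y₁ ^ p ≤ 1 := by
  have hy0 : 0 < y₁ := by linarith
  have hy20 : 0 < y₁ + 1 := by linarith
  refine ⟨?_, ?_, ?_, ?_⟩
  · unfold perronKernel
    have e1 : ((y₁ : ℝ) : ℂ) ^ (1 + (p : ℂ)) = ((y₁ ^ (1 + p) : ℝ) : ℂ) := by
      rw [Complex.ofReal_cpow hy0.le]; push_cast; ring_nf
    have e2 : (((y₁ + 1 : ℝ)) : ℂ) ^ (1 + (p : ℂ)) = (((y₁ + 1) ^ (1 + p) : ℝ) : ℂ) := by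
      rw [Complex.ofReal_cpow hy20.le]; push_cast; ring_nf
    rw [e1, e2]
    push_cast
    ring
  · -- `(1+p) y₁^p ≤ (y₂^{1+p} − y₁^{1+p})` via the integral of `u^p`
    have hint : ∫ u in y₁..(y₁ + 1), u ^ p = ((y₁ + 1) ^ (p + 1) - y₁ ^ (p + 1)) / (p + 1) :=
      integral_rpow (Or.inl (by linarith))
    have hlow : ∫ u in y₁..(y₁ + 1), y₁ ^ p ≤ ∫ u in y₁..(y₁ + 1), u ^ p :=
      intervalIntegral.integral_mono_on (by linarith) intervalIntegrable_const
        (intervalIntegral.intervalIntegrable_rpow' (by linarith)) fun u hu ↦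
          Real.rpow_le_rpow hy0.le hu.1 hp0.le
    rw [intervalIntegral.integral_const, hint, smul_eq_mul, show y₁ + 1 - y₁ = (1 : ℝ) by ring, one_mul] at hlow
    rw [div_le_div_iff₀ hp0 (by positivity), show (1 : ℝ) + p = p + 1 by ring]
    rw [le_div_iff₀ (by linarith)] at hlow
    nlinarith
  · have hint : ∫ u in y₁..(y₁ + 1), u ^ p = ((y₁ + 1) ^ (p + 1) - y₁ ^ (p + 1)) / (p + 1) :=
      integral_rpow (Or.inl (by linarith))
    have hup : ∫ u in y₁..(y₁ + 1), u ^ p ≤ ∫ u in y₁..(y₁ + 1), (y₁ + 1) ^ p :=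
      intervalIntegral.integral_mono_on (by linarith) (intervalIntegral.intervalIntegrable_rpow' (by linarith))
        intervalIntegrable_const fun u hu ↦ Real.rpow_le_rpow (by linarith [hu.1]) hu.2 hp0.le
    rw [intervalIntegral.integral_const, hint, smul_eq_mul, show y₁ + 1 - y₁ = (1 : ℝ) by ring, one_mul] at hup
    rw [div_le_div_iff₀ (by positivity) hp0, show (1 : ℝ) + p = p + 1 by ring]
    rw [div_le_iff₀ (by linarith)] at hup
    nlinarith
  · -- `y₂^p − y₁^p = p ∫_{y₁}^{y₂} u^{p−1} du ≤ p y₁^{p−1} ≤ 1`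
    have hint : ∫ u in y₁..(y₁ + 1), u ^ (p - 1) = ((y₁ + 1) ^ (p - 1 + 1) - y₁ ^ (p - 1 + 1)) / (p - 1 + 1) :=
      integral_rpow (Or.inl (by linarith))
    rw [show p - 1 + 1 = p by ring] at hint
    have hup : ∫ u in y₁..(y₁ + 1), u ^ (p - 1) ≤ ∫ u in y₁..(y₁ + 1), y₁ ^ (p - 1) :=
      intervalIntegral.integral_mono_on (by linarith) (intervalIntegral.intervalIntegrable_rpow' (by linarith))
        intervalIntegrable_const fun u hu ↦ Real.rpow_le_rpow_of_nonpos hy0 hu.1 (by linarith)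
    rw [intervalIntegral.integral_const, hint, smul_eq_mul, show y₁ + 1 - y₁ = (1 : ℝ) by ring, one_mul,
      div_le_iff₀ hp0] at hup
    have h1 : y₁ ^ (p - 1) ≤ 1 := Real.rpow_le_one_of_one_le_of_nonpos hy₁ (by linarith)
    nlinarith


/-! ### The inversion theorem -/

set_option maxHeartbeats 400000 in
/-- **Perron inversion of order one with finitely many real simple poles.** Let `0 ≤ w ≤ W` be a weight on the
generalized integers of `𝒫`, `κ > 0` with `Σ_j λ_j^{−κ} < ∞`, `0 ≤ σ₀ < σ₁ < κ`. Suppose that on the line `Re s = κ`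
the Dirichlet series `Σ_k w_k n_k^{−s}` equals `Σ_{p ∈ S} r_p/(s − p) + H(s)` where `S ⊂ (σ₁, κ)` is a finite set of
real poles with `p ≤ 1`, `H` is holomorphic on `Re s > σ₀`, and `‖H(u + it)‖ ≤ B₀ (1 + |t|)^η` for `σ₁ ≤ u ≤ κ`
(`0 < η < 1`). Then `|Σ_{n_k ≤ x} w_k − Σ_{p ∈ S} Re(r_p) x^p/p| ≤ C x^{σ₁+η}` for `x ≥ 2` (BDR: "By the residue
theorem … `N_𝒫(x) ≤ (main terms at x+1) + (1/2πi)∫_{Re s = σ₁} …`, and similarly from below with `(x−1, x)`"; the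
shifted integral is `≪ x^{σ₁} ∫₀^x B(t)/(σ₁+t) dt + x^{1+σ₁}∫_x^∞ B(t)t^{−2} dt ≪ x^{σ₁+η}`).
[cite: BrouckeDebruyneRevesz2023, proof of Theorem 3.2, (3.5)–(3.8); §5 p. 16] -/
theorem wCount_asymptotic {W : ℝ} (hw0 : ∀ k, 0 ≤ w k) (hwW : ∀ k, |w k| ≤ W)
    {κ : ℝ} (hκ : 0 < κ) (hsum : Summable fun j ↦ P.prime j ^ (-κ))
    {σ₀ σ₁ : ℝ} (hσ₀ : 0 ≤ σ₀) (hσ₀₁ : σ₀ < σ₁) (hσ₁κ : σ₁ < κ)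
    (S : Finset ℝ) (r : ℝ → ℂ) (hS : ∀ p ∈ S, σ₁ < p ∧ p < κ ∧ p ≤ 1)
    {H : ℂ → ℂ} (hH : DifferentiableOn ℂ H {s : ℂ | σ₀ < s.re})
    (hG : ∀ t : ℝ, wSeries P w ((κ : ℂ) + t * I) = polePart S r ((κ : ℂ) + t * I) + H ((κ : ℂ) + t * I))
    {B₀ η : ℝ} (hη0 : 0 < η) (hη1 : η < 1) (hB₀ : 0 ≤ B₀)
    (hHB : ∀ u : ℝ, σ₁ ≤ u → u ≤ κ → ∀ t : ℝ, ‖H ((u : ℂ) + t * I)‖ ≤ B₀ * (1 + |t|) ^ η) :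
    ∃ C : ℝ, ∀ x : ℝ, 2 ≤ x → |wCount P w x - ∑ p ∈ S, (r p).re / p * x ^ p| ≤ C * x ^ (σ₁ + η) := by
  have hσ₁ : 0 < σ₁ := lt_of_le_of_lt hσ₀ hσ₀₁
  -- constants bounding the pole part on the strip and on the two lines
  set Rsum : ℝ := ∑ p ∈ S, ‖r p‖ with hRsum
  set Rσ : ℝ := ∑ p ∈ S, ‖r p‖ / |σ₁ - p| with hRσ
  set Rκ : ℝ := ∑ p ∈ S, ‖r p‖ / |κ - p| with hRκ
  have hRsum0 : 0 ≤ Rsum := Finset.sum_nonneg fun p _ ↦ norm_nonneg _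
  have hRσ0 : 0 ≤ Rσ := Finset.sum_nonneg fun p _ ↦ div_nonneg (norm_nonneg _) (abs_nonneg _)
  have hRκ0 : 0 ≤ Rκ := Finset.sum_nonneg fun p _ ↦ div_nonneg (norm_nonneg _) (abs_nonneg _)
  set B₁ : ℝ := B₀ + Rsum + Rσ + Rκ with hB₁
  have hB₁0 : 0 ≤ B₁ := by positivity
  set B : ℝ → ℝ := fun T ↦ B₁ * (1 + max T 0) ^ η with hBdef
  have hBabs : ∀ t : ℝ, B |t| = B₁ * (1 + |t|) ^ η := fun t ↦ by
    simp only [hBdef, max_eq_left (abs_nonneg t)]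
  have hBmono : Monotone B := by
    intro a b hab
    simp only [hBdef]
    refine mul_le_mul_of_nonneg_left (Real.rpow_le_rpow (by positivity) (by simp [max_le_max hab le_rfl]) hη0.le) hB₁0
  have hB00 : 0 ≤ B 0 := by simp only [hBdef]; positivity
  have hone : ∀ t : ℝ, 1 ≤ (1 + |t|) ^ η := fun t ↦ Real.one_le_rpow (by linarith [abs_nonneg t]) hη0.le
  -- the continued function
  set G : ℂ → ℂ := fun s ↦ polePart S r s + H s with hGdef
  have hσ₁ne : ∀ p ∈ S, σ₁ ≠ p := fun p hp ↦ (hS p hp).1.ne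
  have hκne : ∀ p ∈ S, κ ≠ p := fun p hp ↦ (hS p hp).2.1.ne'
  -- bound on the strip at height `|T| ≥ 1`
  have hstrip : ∀ T : ℝ, 1 ≤ |T| → ∀ u ∈ Icc σ₁ κ, ‖G ((u : ℂ) + T * I)‖ ≤ B |T| := by
    intro T hT u hu
    rw [hBabs]
    have h1 : ‖polePart S r ((u : ℂ) + T * I)‖ ≤ Rsum :=
      norm_polePart_le_of_one_le_im S r (by simpa using hT)
    have h2 := hHB u hu.1 hu.2 T
    calc ‖G ((u : ℂ) + T * I)‖ ≤ ‖polePart S r ((u : ℂ) + T * I)‖ + ‖H ((u : ℂ) + T * I)‖ := norm_add_le _ _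
      _ ≤ Rsum + B₀ * (1 + |T|) ^ η := add_le_add h1 h2
      _ ≤ B₁ * (1 + |T|) ^ η := by
          have g1 := hone T
          have e : (B₀ + Rsum + Rσ + Rκ) * (1 + |T|) ^ η =
              B₀ * (1 + |T|) ^ η + Rsum * (1 + |T|) ^ η + Rσ * (1 + |T|) ^ η + Rκ * (1 + |T|) ^ η := by ring
          have f1 : Rsum ≤ Rsum * (1 + |T|) ^ η := le_mul_of_one_le_right hRsum0 g1
          have f2 : 0 ≤ Rσ * (1 + |T|) ^ η := mul_nonneg hRσ0 (zero_le_one.trans g1)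
          have f3 : 0 ≤ Rκ * (1 + |T|) ^ η := mul_nonneg hRκ0 (zero_le_one.trans g1)
          rw [hB₁, e]; linarith
  -- bounds and measurability on the two vertical lines
  have hline : ∀ u : ℝ, (u = σ₁ ∨ u = κ) →
      (∀ t : ℝ, ‖G ((u : ℂ) + t * I)‖ ≤ B |t|) ∧ Continuous fun t : ℝ ↦ G ((u : ℂ) + t * I) := by
    intro u hu
    have hune : ∀ p ∈ S, u ≠ p := by
      rcases hu with rfl | rfl
      · exact hσ₁ne
      · exact hκne
    have huIcc : σ₁ ≤ u ∧ u ≤ κ := by rcases hu with rfl | rfl <;> constructor <;> linarith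
    have hRu : ∑ p ∈ S, ‖r p‖ / |u - p| ≤ Rσ + Rκ := by
      rcases hu with rfl | rfl
      · linarith
      · linarith
    constructor
    · intro t
      rw [hBabs]
      have h1 := norm_polePart_le_line S r hune t
      have h2 := hHB u huIcc.1 huIcc.2 t
      calc ‖G ((u : ℂ) + t * I)‖ ≤ ‖polePart S r ((u : ℂ) + t * I)‖ + ‖H ((u : ℂ) + t * I)‖ := norm_add_le _ _
        _ ≤ (Rσ + Rκ) + B₀ * (1 + |t|) ^ η := add_le_add (h1.trans hRu) h2
        _ ≤ B₁ * (1 + |t|) ^ η := by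
            have g1 := hone t
            have e : (B₀ + Rsum + Rσ + Rκ) * (1 + |t|) ^ η =
                B₀ * (1 + |t|) ^ η + Rsum * (1 + |t|) ^ η + Rσ * (1 + |t|) ^ η + Rκ * (1 + |t|) ^ η := by ring
            have f1 : 0 ≤ Rsum * (1 + |t|) ^ η := mul_nonneg hRsum0 (zero_le_one.trans g1)
            have f2 : Rσ ≤ Rσ * (1 + |t|) ^ η := le_mul_of_one_le_right hRσ0 g1
            have f3 : Rκ ≤ Rκ * (1 + |t|) ^ η := le_mul_of_one_le_right hRκ0 g1
            rw [hB₁, e]; linarith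
    · have hHc : Continuous fun t : ℝ ↦ H ((u : ℂ) + t * I) := by
        refine hH.continuousOn.comp_continuous (by fun_prop) fun t ↦ ?_
        show σ₀ < ((u : ℂ) + t * I).re
        simp; linarith [huIcc.1]
      exact (continuous_polePart_line S r hune).add hHc
  obtain ⟨hGσ, hGσc⟩ := hline σ₁ (Or.inl rfl)
  obtain ⟨hGκ, hGκc⟩ := hline κ (Or.inr rfl)
  -- `B(T)/T² → 0` and integrability of `B(t)/t²` beyond `X ≥ 1`
  have hBlim : Tendsto (fun T : ℝ ↦ B T / T ^ 2) atTop (𝓝 0) := by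
    have hup : Tendsto (fun T : ℝ ↦ B₁ * (2 : ℝ) ^ η * T ^ (-(2 - η))) atTop (𝓝 (B₁ * 2 ^ η * 0)) :=
      (tendsto_rpow_neg_atTop (by linarith)).const_mul _
    rw [mul_zero] at hup
    refine tendsto_of_tendsto_of_tendsto_of_le_of_le' tendsto_const_nhds hup ?_ ?_
    · filter_upwards [eventually_ge_atTop (1 : ℝ)] with T hT
      have : 0 ≤ B T := hB00.trans (hBmono (by linarith))
      positivity
    · filter_upwards [eventually_ge_atTop (1 : ℝ)] with T hT
      have hT0 : 0 < T := by linarith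
      simp only [hBdef, max_eq_left hT0.le]
      have h1 : (1 + T) ^ η ≤ (2 * T) ^ η := Real.rpow_le_rpow (by linarith) (by linarith) hη0.le
      rw [Real.mul_rpow zero_le_two hT0.le] at h1
      rw [div_le_iff₀ (by positivity), show B₁ * 2 ^ η * T ^ (-(2 - η)) * T ^ 2 = B₁ * (2 ^ η * T ^ η) by
        rw [show -(2 - η) = η - 2 by ring, mul_assoc, mul_assoc, ← Real.rpow_two, ← Real.rpow_add hT0]; ring_nf]
      exact mul_le_mul_of_nonneg_left h1 hB₁0
  have hBi : ∀ X : ℝ, 1 ≤ X → IntegrableOn (fun t ↦ B t / t ^ 2) (Ioi X) := by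
    intro X hX
    have h := ((setIntegral_Ioi_rpow_div_sq_le hη0.le hη1 hX).1).const_mul B₁
    refine IntegrableOn.congr_fun h (fun t ht ↦ ?_) measurableSet_Ioi
    have ht : 0 ≤ t := by linarith [hX.trans (le_of_lt ht)]
    simp only [hBdef, max_eq_left ht]
    ring
  -- the core estimate for a pair `(y₁, y₁ + 1)`, `y₁ ≥ 1`
  set C₁ : ℝ := (1 / (2 * π)) * (4 * B₁ * ((1 / σ₁ + 1) * 2 ^ η / η) + 4 * B₁ * (2 ^ η / (1 - η))) with hC₁
  have hC₁0 : 0 ≤ C₁ := by positivity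
  have hcore : ∀ y₁ : ℝ, 1 ≤ y₁ →
      |(wRiesz P w (y₁ + 1) - wRiesz P w y₁) - ∑ p ∈ S, (r p * perronKernel y₁ (y₁ + 1) p).re| ≤
        C₁ * (y₁ + 1) ^ (σ₁ + η) := by
    intro y₁ hy₁
    set y₂ := y₁ + 1 with hy₂
    have hy₁0 : 0 < y₁ := by linarith
    have hy₂0 : 0 < y₂ := by linarith
    have hy₂1 : 1 ≤ y₂ := by linarith
    -- integrability on both lines (first part of `perron_vertical_norm_le`)
    have hVσ := perron_vertical_norm_le (G := G) (B := B) (y₁ := y₁) (y₂ := y₂) (X := y₂) hσ₁ hy₁0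
      (by rw [hy₂]; linarith) (by rw [hy₂]) hy₂0 hGσc.aestronglyMeasurable hGσ hB00 hBmono (hBi y₂ hy₂1)
    have hVκ := perron_vertical_norm_le (G := G) (B := B) (y₁ := y₁) (y₂ := y₂) (X := y₂) hκ hy₁0
      (by rw [hy₂]; linarith) (by rw [hy₂]) hy₂0 hGκc.aestronglyMeasurable hGκ hB00 hBmono (hBi y₂ hy₂1)
    -- the contour shift
    have hshift := perron_integral_eq_residues_add (H := H) (B := B) (y₁ := y₁) (y₂ := y₂) (T₁ := 1) S r hσ₀ hσ₀₁
      hσ₁κ hy₁ (by linarith) (fun p hp ↦ ⟨(hS p hp).1, (hS p hp).2.1⟩) hH hVκ.1 hVσ.1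
      (fun T hT u hu ↦ hstrip T hT u hu) hBlim
    -- Perron's formula on the line `κ`
    have hperron := wRiesz_sub_eq_integral hwW hy₁0 hy₂0 hκ hsum (y₁ := y₁) (y₂ := y₂)
    have hint_eq : ∫ t : ℝ, perronKernel y₁ y₂ ((κ : ℂ) + t * I) * wSeries P w ((κ : ℂ) + t * I) =
        ∫ t : ℝ, perronKernel y₁ y₂ ((κ : ℂ) + t * I) * (polePart S r ((κ : ℂ) + t * I) + H ((κ : ℂ) + t * I)) :=
      integral_congr_ae (Eventually.of_forall fun t ↦ by simp only [hG t])
    rw [hint_eq, hshift] at hperron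
    -- the shifted integral is small
    set Iσ : ℂ := ∫ t : ℝ, perronKernel y₁ y₂ ((σ₁ : ℂ) + t * I) *
      (polePart S r ((σ₁ : ℂ) + t * I) + H ((σ₁ : ℂ) + t * I)) with hIσ
    have hIσ_le : ‖Iσ‖ ≤ (2 * π) * C₁ * y₂ ^ (σ₁ + η) := by
      have h1 : ‖Iσ‖ ≤ ∫ t : ℝ, ‖perronKernel y₁ y₂ ((σ₁ : ℂ) + t * I) * G ((σ₁ : ℂ) + t * I)‖ :=
        norm_integral_le_integral_norm _
      have h2 := hVσ.2
      obtain ⟨-, hIoc⟩ := setIntegral_Ioc_rpow_div_le hσ₁ hη0 hy₂0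
      obtain ⟨-, hIoi⟩ := setIntegral_Ioi_rpow_div_sq_le hη0.le hη1 hy₂1
      have h3 : ∫ t in Ioc 0 y₂, B t / (σ₁ + t) = B₁ * ∫ t in Ioc 0 y₂, (1 + t) ^ η / (σ₁ + t) := by
        rw [← integral_const_mul]
        refine setIntegral_congr_fun measurableSet_Ioc fun t ht ↦ ?_
        simp only [hBdef, max_eq_left ht.1.le]; ring
      have h4 : ∫ t in Ioi y₂, B t / t ^ 2 = B₁ * ∫ t in Ioi y₂, (1 + t) ^ η / t ^ 2 := by
        rw [← integral_const_mul]
        refine setIntegral_congr_fun measurableSet_Ioi fun t ht ↦ ?_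
        have : 0 ≤ t := by linarith [hy₂1.trans (le_of_lt ht)]
        simp only [hBdef, max_eq_left this]; ring
      rw [h3, h4] at h2
      have hy₂σ : 0 ≤ y₂ ^ σ₁ := Real.rpow_nonneg hy₂0.le _
      have hy₂σ' : 0 ≤ y₂ ^ (1 + σ₁) := Real.rpow_nonneg hy₂0.le _
      -- `(1 + y₂)^η ≤ 2^η y₂^η` and `y₂^{1+σ₁} y₂^{η−1} = y₂^{σ₁+η}`
      have h5 : (1 + y₂) ^ η ≤ (2 : ℝ) ^ η * y₂ ^ η := by
        rw [← Real.mul_rpow zero_le_two hy₂0.le]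
        exact Real.rpow_le_rpow (by linarith) (by linarith) hη0.le
      have h6 : y₂ ^ σ₁ * y₂ ^ η = y₂ ^ (σ₁ + η) := by rw [← Real.rpow_add hy₂0]
      have h7 : y₂ ^ (1 + σ₁) * y₂ ^ (η - 1) = y₂ ^ (σ₁ + η) := by rw [← Real.rpow_add hy₂0]; ring_nf
      have hA : 4 * y₂ ^ σ₁ * (B₁ * ∫ t in Ioc 0 y₂, (1 + t) ^ η / (σ₁ + t)) ≤
          4 * B₁ * ((1 / σ₁ + 1) * 2 ^ η / η) * y₂ ^ (σ₁ + η) := by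
        calc 4 * y₂ ^ σ₁ * (B₁ * ∫ t in Ioc 0 y₂, (1 + t) ^ η / (σ₁ + t))
            ≤ 4 * y₂ ^ σ₁ * (B₁ * ((1 / σ₁ + 1) * (1 + y₂) ^ η / η)) := by gcongr
          _ ≤ 4 * y₂ ^ σ₁ * (B₁ * ((1 / σ₁ + 1) * ((2 : ℝ) ^ η * y₂ ^ η) / η)) := by gcongr
          _ = 4 * B₁ * ((1 / σ₁ + 1) * 2 ^ η / η) * (y₂ ^ σ₁ * y₂ ^ η) := by ring
          _ = 4 * B₁ * ((1 / σ₁ + 1) * 2 ^ η / η) * y₂ ^ (σ₁ + η) := by rw [h6]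
      have hBB : 4 * y₂ ^ (1 + σ₁) * (B₁ * ∫ t in Ioi y₂, (1 + t) ^ η / t ^ 2) ≤
          4 * B₁ * (2 ^ η / (1 - η)) * y₂ ^ (σ₁ + η) := by
        calc 4 * y₂ ^ (1 + σ₁) * (B₁ * ∫ t in Ioi y₂, (1 + t) ^ η / t ^ 2)
            ≤ 4 * y₂ ^ (1 + σ₁) * (B₁ * ((2 : ℝ) ^ η * y₂ ^ (η - 1) / (1 - η))) := by gcongr
          _ = 4 * B₁ * (2 ^ η / (1 - η)) * (y₂ ^ (1 + σ₁) * y₂ ^ (η - 1)) := by ring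
          _ = 4 * B₁ * (2 ^ η / (1 - η)) * y₂ ^ (σ₁ + η) := by rw [h7]
      calc ‖Iσ‖ ≤ _ := h1
        _ ≤ _ := h2
        _ ≤ 4 * B₁ * ((1 / σ₁ + 1) * 2 ^ η / η) * y₂ ^ (σ₁ + η) + 4 * B₁ * (2 ^ η / (1 - η)) * y₂ ^ (σ₁ + η) :=
            add_le_add hA hBB
        _ = (2 * π) * C₁ * y₂ ^ (σ₁ + η) := by rw [hC₁]; field_simp
    -- take real parts
    have hre := congrArg Complex.re hperron
    rw [ofReal_re] at hre
    have hre2 : ((1 / (2 * π) : ℂ) * (2 * π * ∑ p ∈ S, r p * perronKernel y₁ y₂ p + Iσ)).re =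
        ∑ p ∈ S, (r p * perronKernel y₁ y₂ p).re + ((1 / (2 * π) : ℂ) * Iσ).re := by
      rw [mul_add, add_re, ← mul_assoc, show (1 / (2 * π) : ℂ) * (2 * π) = 1 by
        have : (π : ℂ) ≠ 0 := ofReal_ne_zero.mpr Real.pi_pos.ne'
        field_simp, one_mul, re_sum]
    rw [hre2] at hre
    rw [hre, show ∑ p ∈ S, (r p * perronKernel y₁ y₂ p).re + ((1 / (2 * π) : ℂ) * Iσ).re -
      ∑ p ∈ S, (r p * perronKernel y₁ y₂ p).re = ((1 / (2 * π) : ℂ) * Iσ).re by ring]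
    calc |((1 / (2 * π) : ℂ) * Iσ).re| ≤ ‖(1 / (2 * π) : ℂ) * Iσ‖ := abs_re_le_norm _
      _ = (1 / (2 * π)) * ‖Iσ‖ := by
          rw [norm_mul, show (1 / (2 * π) : ℂ) = ((1 / (2 * π) : ℝ) : ℂ) by push_cast; ring, Complex.norm_real,
            Real.norm_eq_abs, abs_of_pos (by positivity)]
      _ ≤ (1 / (2 * π)) * ((2 * π) * C₁ * y₂ ^ (σ₁ + η)) := mul_le_mul_of_nonneg_left hIσ_le (by positivity)
      _ = C₁ * y₂ ^ (σ₁ + η) := by field_simp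
  -- main terms: `|Re(r_p) K(y₁, y₁+1; p) − Re(r_p) x^p/p| ≤ |Re r_p|/p` for `x ∈ {y₁, y₁+1}`
  set Cmain : ℝ := ∑ p ∈ S, |(r p).re| / p with hCmain
  have hCmain0 : 0 ≤ Cmain := Finset.sum_nonneg fun p hp ↦ div_nonneg (abs_nonneg _) (hσ₁.trans (hS p hp).1).le
  have hmain : ∀ y₁ : ℝ, 1 ≤ y₁ → ∀ x : ℝ, (x = y₁ ∨ x = y₁ + 1) →
      |∑ p ∈ S, (r p * perronKernel y₁ (y₁ + 1) p).re - ∑ p ∈ S, (r p).re / p * x ^ p| ≤ Cmain := by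
    intro y₁ hy₁ x hx
    rw [← Finset.sum_sub_distrib, hCmain]
    refine (Finset.abs_sum_le_sum_abs _ _).trans (Finset.sum_le_sum fun p hp ↦ ?_)
    obtain ⟨hσp, -, hp1⟩ := hS p hp
    have hp0 : 0 < p := hσ₁.trans hσp
    obtain ⟨hK, hlo, hhi, hdiff⟩ := perronKernel_real_bounds hy₁ hp0 hp1
    set Kr : ℝ := ((y₁ + 1) ^ (1 + p) - y₁ ^ (1 + p)) / (p * (p + 1)) with hKr
    rw [hK, show (r p * (Kr : ℂ)).re = (r p).re * Kr by simp [mul_re], show (r p).re * Kr - (r p).re / p * x ^ p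
      = (r p).re * (Kr - x ^ p / p) by ring, abs_mul]
    refine (mul_le_mul_of_nonneg_left (show |Kr - x ^ p / p| ≤ 1 / p from ?_) (abs_nonneg _)).trans (by rw [mul_one_div])
    have hp' : 0 ≤ 1 / p := by positivity
    have h2 : (y₁ + 1) ^ p / p - y₁ ^ p / p ≤ 1 / p := by
      rw [← sub_div]; exact div_le_div_of_nonneg_right hdiff hp0.le
    rw [abs_le]
    rcases hx with rfl | rfl
    · constructor <;> linarith
    · constructor <;> linarith
  -- assembly
  refine ⟨Cmain + C₁ * 2 ^ (σ₁ + η), fun x hx ↦ ?_⟩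
  have hx0 : 0 < x := by linarith
  have hx1 : 1 ≤ x := by linarith
  have hxpow : 1 ≤ x ^ (σ₁ + η) := Real.one_le_rpow hx1 (by linarith)
  have hup := wCount_le_wRiesz_sub hw0 x (P := P)
  have hlow := wRiesz_sub_le_wCount hw0 x (P := P)
  have hc1 := hcore x hx1
  have hc2 := hcore (x - 1) (by linarith)
  rw [show x - 1 + 1 = x by ring] at hc2
  have hm1 := hmain x hx1 x (Or.inl rfl)
  have hm2 := hmain (x - 1) (by linarith) x (Or.inr (by ring))
  rw [show x - 1 + 1 = x by ring] at hm2
  -- `(x+1)^{σ₁+η} ≤ 2^{σ₁+η} x^{σ₁+η}`, `x^{σ₁+η} ≤ 2^{σ₁+η} x^{σ₁+η}`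
  have hpow1 : (x + 1) ^ (σ₁ + η) ≤ (2 : ℝ) ^ (σ₁ + η) * x ^ (σ₁ + η) := by
    rw [← Real.mul_rpow zero_le_two hx0.le]
    exact Real.rpow_le_rpow (by linarith) (by linarith) (by linarith)
  have hpow2 : x ^ (σ₁ + η) ≤ (2 : ℝ) ^ (σ₁ + η) * x ^ (σ₁ + η) :=
    le_mul_of_one_le_left (zero_le_one.trans hxpow) (Real.one_le_rpow one_le_two (by linarith))
  have e1 : Cmain ≤ Cmain * x ^ (σ₁ + η) := le_mul_of_one_le_right hCmain0 hxpow
  have e2 : C₁ * x ^ (σ₁ + η) ≤ C₁ * ((2 : ℝ) ^ (σ₁ + η) * x ^ (σ₁ + η)) := mul_le_mul_of_nonneg_left hpow2 hC₁0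
  have e3 : C₁ * (x + 1) ^ (σ₁ + η) ≤ C₁ * ((2 : ℝ) ^ (σ₁ + η) * x ^ (σ₁ + η)) := mul_le_mul_of_nonneg_left hpow1 hC₁0
  have e4 : (Cmain + C₁ * 2 ^ (σ₁ + η)) * x ^ (σ₁ + η) = Cmain * x ^ (σ₁ + η) + C₁ * (2 ^ (σ₁ + η) * x ^ (σ₁ + η)) := by
    ring
  rw [abs_le, e4]
  constructor
  · -- lower bound from `(x − 1, x)`
    have h := (abs_le.mp hc2).1
    have h' := (abs_le.mp hm2).1
    linarith
  · have h := (abs_le.mp hc1).2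
    have h' := (abs_le.mp hm1).2
    linarith

end Literature.NumberTheory.BeurlingPrimes
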